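import Summits.PneNP.PneNP.Theses.EquivariantThetaLift
import Literature.Computability.Complexity.Mod2SosDegreeProof
import HarnessLib

/-!
# Route `EquivariantThetaLift`, item `GrigorievMod2`: closed by the in-tree discharge

The route item `Summit.PneNP.PneNP.Theses.EquivariantThetaLift.GrigorievMod2` is the named Literature
fact `Literature.Computability.Complexity.Grigoriev2001_mod2Degree` (Grigoriev's linear degree lower
bound for static SOS refutations of `MOD 2`), which is PROVED in the tree
(`Literature/Computability/Complexity/Mod2SosDegreeProof.lean`, `Grigoriev2001_mod2Degree_holds`:
Tseitin on the Reingold–Vadhan–Wigderson expanders, Grigoriev's Lemma 9/10 substitution, GS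
pseudo-moments and weak duality). Nothing is re-proved here (D-0059).
-/

set_option linter.dupNamespace false -- `Summit.PneNP.PneNP.…`: summit = sub-problem (D-0017)

namespace Summit.PneNP.PneNP.Theorems

/-- **Item `GrigorievMod2` of route `EquivariantThetaLift`** — Grigoriev's degree bound for `MOD 2`,
by the tree theorem `Literature.Computability.Complexity.Grigoriev2001_mod2Degree_holds`.
[cite: Grigoriev2001TCS, Cor. 2] -/
theorem GrigorievMod2_proof : Summit.PneNP.PneNP.Theses.EquivariantThetaLift.GrigorievMod2 :=
  Literature.Computability.Complexity.Grigoriev2001_mod2Degree_holds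

end Summit.PneNP.PneNP.Theorems
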